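/-
HONEST FRAMING: certified error envelopes and provably optimal rounding/accumulation schemes for
low-precision formats under stated cost models; every table by two implementations; no hardware
or vendor claims.
-/
import Summits.Ventures.CertifiedArithmetic.LowPrec.OptDemotionRoutingGapConvex
import Summits.Ventures.CertifiedArithmetic.LowPrec.OptDemotionRoutingTwoFamRatio

/-!
# The demotion law (Theorem T8), part 10g: THREE-FAMILY COORDINATES — deletion, and the splits of a three-bit configuration

Infrastructure for all-`q` rows whose coordinates have two offset bits (opt gen 15 §5b, the
"three-family cone": `x_(s,i) = BR_t(1 + 2^-s + 2^-i)`):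
* `treeBR_le_erase_add` — SINGLE-FAMILY DELETION (opt's (DEL) row, gen14 §2): for a routable `S`
  and `b ∈ S`, `BR_t(S) ≤ BR_t(S ∖ {b}) + BR_t({b})` (a supporting routing of `S` scores, on the
  family of `b` alone, at most the value of the single bit `b`; parts 8b/8f);
* `treeBR_le_of_subset` — (M) for sub-configurations; `two_treeBR_pair_le` — (MC) for `{0, e}` in
  routing values;
* `split_three_le` — THE NODE RULE FOR A THREE-BIT CONFIGURATION `{0, -a, -b}` (`1 ≤ a < b ≤ q-1`):
  every valid split of part 8a is dominated by one of the EIGHT injected options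
  `({0} ∪ P | ({-a,-b} ∖ P) ∪ {-q})`, `P ⊆ {-a, -b}`, in either orientation (opt's recursion
  `threefam.py`, `2^{|T|+1}` options; cross-checked against the engine tables).
Part 10h uses these to prove opt's R32 (the single-bit top-level `O`-rows) for every `q`.
-/

namespace Summit.Ventures.CertifiedArithmetic.LowPrec.Opt

open Literature.ComputerArithmetic.JeannerodRump2018
open Literature.ComputerArithmetic.JeannerodRump2018.SumTree

section ThreeFam

variable {q : ℕ}

/-! ## Deletion of one bit family -/

/-- **SINGLE-FAMILY DELETION (opt's (DEL))**: for a routable configuration `S` and `b ∈ S`,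
`BR_t(S) ≤ BR_t(S ∖ {b}) + BR_t({b})` — every tree, every precision. -/
theorem treeBR_le_erase_add (t : SumTree) {S : Finset ℤ} (hS : Routable q S) {b : ℤ} (hb : b ∈ S) :
    treeBR q t S ≤ treeBR q t (S.erase b) + treeBR q t {b} := by
  classical
  have h2pos : ∀ e : ℤ, (0 : ℚ) < (2 : ℚ) ^ e := fun e => zpow_pos (by norm_num) e
  obtain ⟨G, -, hGeq, hsupp⟩ := exists_isCoef_support (q := q) (W := fun e => (2 : ℚ) ^ e)
    (fun e => (h2pos e).le) t hS
  have hbS : b ∉ S.erase b := Finset.notMem_erase b S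
  have hins : insert b (S.erase b) = S := Finset.insert_erase hb
  -- the part off the family of b
  have hlo : score (fun e => (2 : ℚ) ^ e) G - score (classW q b) G ≤ treeBR q t (S.erase b) :=
    score_delete_le t hbS (by rw [hins]; exact hS) (by rw [hins]; exact hsupp)
  -- the family of b alone scores at most BR{b}
  have hhi : score (classW q b) G ≤ treeBR q t {b} := by
    have h1 := hsupp (classW q b)
    have hdel := treeBRw_le_filter (q := q) (W := classW q b) (classW_nonneg q b)
      (p := fun e => (q : ℤ) ∣ e - b) (fun e => by rw [dvd_sub_shift_iff])
      (fun e he => by unfold classW; rw [if_neg he]) t S hS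
    have hfil : S.filter (fun e => (q : ℤ) ∣ e - b) = {b} := by
      ext e
      simp only [Finset.mem_filter, Finset.mem_singleton]
      constructor
      · rintro ⟨he, h⟩; exact eq_of_routable_of_dvd hS he hb h
      · rintro rfl; exact ⟨hb, by simp⟩
    rw [hfil] at hdel
    have hcl : treeBRw q (classW q b) t {b} = treeBR q t {b} := by
      rw [treeBR]
      refine treeBRw_congr (p := fun e => (q : ℤ) ∣ e - b)
        (fun e h => (dvd_sub_shift_iff _ _ _).2 h) (fun e h => ?_) t _ (fun e he => ?_)
      · unfold classW; rw [if_pos h]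
      · rw [Finset.mem_singleton] at he; rw [he]; simp
    linarith
  rw [treeBR, ← hGeq]
  linarith

/-! ## (M) for sub-configurations and (MC) for `{0, e}` -/

/-- A sub-configuration of a routable configuration scores at most as much (part 8i (M)). -/
theorem treeBR_le_of_subset (hq : 1 ≤ q) (t : SumTree) {B C : Finset ℤ} (hBC : B ⊆ C)
    (hC : Routable q C) : treeBR q t B ≤ treeBR q t C := by
  by_cases hne : B.Nonempty
  · refine treeBR_mono hq t hne (hne.mono hBC) (hC.mono hBC) hC ?_
    rw [val_eq_sdiff_add hBC]; linarith [val_nonneg (C \ B)]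
  · rw [Finset.not_nonempty_iff_eq_empty.1 hne, treeBR, treeBRw_empty]; exact treeBR_nonneg q t C

/-- (MC) IN ROUTING VALUES for a two-bit configuration: `2 BR_t{0, e} ≤ BR_t{0, e+1} + BR_t{0}`
for `1 - q ≤ e ≤ -2` (part 8h at `{0, e}` in the direction of the bit `e`). -/
theorem two_treeBR_pair_le (t : SumTree) {e : ℤ} (he2 : e ≤ -2) (heq : 1 - (q : ℤ) ≤ e) :
    2 * treeBR q t {0, e} ≤ treeBR q t {0, e + 1} + treeBR q t {0} := by
  classical
  have hS : Routable q ({0, e} : Finset ℤ) := routable_zero_pair (by omega) heq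
  have hS' : Routable q ({0, e + 1} : Finset ℤ) := routable_zero_pair (by omega) (by omega)
  have hrun : ∀ i : ℕ, i ≤ 0 → e + (i : ℤ) ∈ ({0, e} : Finset ℤ) := by
    intro i hi
    have : i = 0 := by omega
    subst this; simp
  have hβ' : e + (((0 : ℕ) : ℤ) + 1) ∉ ({0, e} : Finset ℤ) := by
    simp only [Nat.cast_zero, zero_add, Finset.mem_insert, Finset.mem_singleton]; omega
  have e1 : insert (e + (((0 : ℕ) : ℤ) + 1))
      (({0, e} : Finset ℤ) \ (Finset.range (0 + 1)).image (fun i : ℕ => e + (i : ℤ))) =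
        ({0, e + 1} : Finset ℤ) := by
    ext z
    simp only [Nat.cast_zero, zero_add, Finset.range_one, Finset.image_singleton, add_zero,
      Finset.mem_insert, Finset.mem_sdiff, Finset.mem_singleton]
    omega
  have e2 : ({0, e} : Finset ℤ).erase e = {0} := by
    ext z
    simp only [Finset.mem_erase, Finset.mem_insert, Finset.mem_singleton]
    omega
  have hmc := treeBR_midconvex (q := q) t hS (β := e) (j := 0) hrun hβ' (by rw [e1]; exact hS')
  rw [e1, e2] at hmc
  exact hmc

/-! ## Splits of a three-bit configuration -/

/-- The subsets of a pair. -/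
theorem subset_two_cases {x y : ℤ} {P : Finset ℤ} (h : P ⊆ {x, y}) :
    P = ∅ ∨ P = {x} ∨ P = {y} ∨ P = {x, y} := by
  by_cases hx : x ∈ P
  · by_cases hy : y ∈ P
    · right; right; right
      exact Finset.Subset.antisymm h (by
        intro z hz; rcases Finset.mem_insert.1 hz with rfl | hz
        · exact hx
        · rw [Finset.mem_singleton] at hz; rw [hz]; exact hy)
    · right; left
      ext z; simp only [Finset.mem_singleton]
      constructor
      · intro hz
        have := h hz; simp only [Finset.mem_insert, Finset.mem_singleton] at this
        rcases this with rfl | rfl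
        · rfl
        · exact absurd hz hy
      · rintro rfl; exact hx
  · by_cases hy : y ∈ P
    · right; right; left
      ext z; simp only [Finset.mem_singleton]
      constructor
      · intro hz
        have := h hz; simp only [Finset.mem_insert, Finset.mem_singleton] at this
        rcases this with rfl | rfl
        · exact absurd hz hx
        · rfl
      · rintro rfl; exact hy
    · left
      ext z; simp only [Finset.notMem_empty, iff_false]
      intro hz
      have := h hz; simp only [Finset.mem_insert, Finset.mem_singleton] at this
      rcases this with rfl | rfl
      · exact hx hz
      · exact hy hz

/-- THE FOUR A-ORIENTED OPTIONS of a three-bit configuration `S = {0, -a, -b}`: a valid split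
`(A', B')` of `S` (injection at `-q`) whose first part holds the top bit `0` is dominated by the
injected option of `P = A' ∖ {0} ⊆ {-a, -b}`. -/
theorem split_three_le_left (hq : 1 ≤ q) (A B : SumTree) {a b : ℕ} (ha : 1 ≤ a) (hab : a < b)
    (hbq : b + 1 ≤ q) {A' B' : Finset ℤ}
    (h : (A', B') ∈ splits q ({0, -(a : ℤ), -(b : ℤ)} : Finset ℤ) 0) (h0 : (0 : ℤ) ∈ A') :
    treeBR q A A' + treeBR q B B' ≤
      max (max (treeBR q A {0, -(a : ℤ), -(b : ℤ)} + treeBR q B {-(q : ℤ)})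
            (treeBR q A {0, -(a : ℤ)} + treeBR q B {-(b : ℤ), -(q : ℤ)}))
        (max (treeBR q A {0, -(b : ℤ)} + treeBR q B {-(a : ℤ), -(q : ℤ)})
            (treeBR q A {0} + treeBR q B {-(a : ℤ), -(b : ℤ), -(q : ℤ)})) := by
  classical
  obtain ⟨hA, hB, hdisj, hcov, hrA, hrB⟩ := of_mem_splits (A := A') (B := B') h
  rw [zero_sub] at hA hB
  -- the injected bit is not with the top
  have hιA : -(q : ℤ) ∉ A' := fun hι => not_routable_of_mem_mem hrA h0 (by rwa [zero_sub])
  -- B' is inside the complement of A' in S ∪ {-q}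
  have hBsub : ∀ z, z ∈ B' → z = -(q : ℤ) ∨ (z ∈ ({0, -(a : ℤ), -(b : ℤ)} : Finset ℤ) ∧ z ∉ A') := by
    intro z hz
    have hzA : z ∉ A' := fun hzA => Finset.disjoint_left.1 hdisj hzA hz
    rcases Finset.mem_insert.1 (hB hz) with hz' | hz'
    · exact Or.inl hz'
    · exact Or.inr ⟨hz', hzA⟩
  -- routability of the low configurations
  have hRlow : Routable q ({-(a : ℤ), -(b : ℤ), -(q : ℤ)} : Finset ℤ) := by
    intro x hx y hy
    simp only [Finset.mem_insert, Finset.mem_singleton] at hx hy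
    rcases hx with rfl | rfl | rfl <;> rcases hy with rfl | rfl | rfl <;> omega
  -- P = A' ∖ {0} ⊆ {-a, -b}
  have hP : A'.erase 0 ⊆ ({-(a : ℤ), -(b : ℤ)} : Finset ℤ) := by
    intro z hz
    obtain ⟨hz0, hzA⟩ := Finset.mem_erase.1 hz
    have := hA hzA
    simp only [Finset.mem_insert, Finset.mem_singleton] at this ⊢
    rcases this with h1 | h1 | h1 | h1
    · exact absurd (h1 ▸ hzA) hιA
    · exact absurd h1 hz0
    · exact Or.inl h1
    · exact Or.inr h1
  have hA'eq : A' = insert 0 (A'.erase 0) := (Finset.insert_erase h0).symm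
  -- generic step: given P, bound B' by the complement with the injection
  have key : ∀ (P R : Finset ℤ), A'.erase 0 = P →
      (∀ z, z ∈ ({0, -(a : ℤ), -(b : ℤ)} : Finset ℤ) → z ∉ A' → z ∈ R) →
      R ⊆ ({-(a : ℤ), -(b : ℤ), -(q : ℤ)} : Finset ℤ) → -(q : ℤ) ∈ R →
      treeBR q A A' + treeBR q B B' ≤ treeBR q A (insert 0 P) + treeBR q B R := by
    intro P R hPe hR hRsub hιR
    have e1 : A' = insert 0 P := by rw [hA'eq, hPe]
    have hB'R : B' ⊆ R := by
      intro z hz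
      rcases hBsub z hz with rfl | ⟨hzS, hzA⟩
      · exact hιR
      · exact hR z hzS hzA
    rw [e1]
    exact add_le_add le_rfl (treeBR_le_of_subset hq B hB'R (hRlow.mono hRsub))
  rcases subset_two_cases hP with hP0 | hPa | hPb | hPab
  · -- P = ∅ : option (0 | -a,-b,-q)
    have := key ∅ {-(a : ℤ), -(b : ℤ), -(q : ℤ)} hP0 (by
        intro z hz hzA
        simp only [Finset.mem_insert, Finset.mem_singleton] at hz ⊢
        rcases hz with rfl | rfl | rfl
        · exact absurd h0 hzA
        · exact Or.inl rfl
        · exact Or.inr (Or.inl rfl))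
      (fun z hz => hz) (by simp)
    rw [show (insert (0 : ℤ) (∅ : Finset ℤ)) = {0} from rfl] at this
    exact le_trans this (le_max_of_le_right (le_max_right _ _))
  · -- P = {-a} : option (0,-a | -b,-q)
    have hbA : -(b : ℤ) ∉ A' := by
      intro hbA
      have : -(b : ℤ) ∈ A'.erase 0 := Finset.mem_erase.2 ⟨by omega, hbA⟩
      rw [hPa, Finset.mem_singleton] at this; omega
    have := key {-(a : ℤ)} {-(b : ℤ), -(q : ℤ)} hPa (by
        intro z hz hzA
        simp only [Finset.mem_insert, Finset.mem_singleton] at hz ⊢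
        rcases hz with rfl | rfl | rfl
        · exact absurd h0 hzA
        · exfalso; apply hzA
          have : -(a : ℤ) ∈ A'.erase 0 := by rw [hPa]; simp
          exact Finset.mem_of_mem_erase this
        · exact Or.inl rfl)
      (by intro z hz; simp only [Finset.mem_insert, Finset.mem_singleton] at hz ⊢; tauto) (by simp)
    exact le_trans this (le_max_of_le_left (le_max_right _ _))
  · -- P = {-b} : option (0,-b | -a,-q)
    have := key {-(b : ℤ)} {-(a : ℤ), -(q : ℤ)} hPb (by
        intro z hz hzA
        simp only [Finset.mem_insert, Finset.mem_singleton] at hz ⊢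
        rcases hz with rfl | rfl | rfl
        · exact absurd h0 hzA
        · exact Or.inl rfl
        · exfalso; apply hzA
          have : -(b : ℤ) ∈ A'.erase 0 := by rw [hPb]; simp
          exact Finset.mem_of_mem_erase this)
      (by intro z hz; simp only [Finset.mem_insert, Finset.mem_singleton] at hz ⊢; tauto) (by simp)
    exact le_trans this (le_max_of_le_right (le_max_left _ _))
  · -- P = {-a,-b} : option (0,-a,-b | -q)
    have := key {-(a : ℤ), -(b : ℤ)} {-(q : ℤ)} hPab (by
        intro z hz hzA
        simp only [Finset.mem_insert, Finset.mem_singleton] at hz ⊢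
        rcases hz with rfl | rfl | rfl
        · exact absurd h0 hzA
        · exfalso; apply hzA
          have : -(a : ℤ) ∈ A'.erase 0 := by rw [hPab]; simp
          exact Finset.mem_of_mem_erase this
        · exfalso; apply hzA
          have : -(b : ℤ) ∈ A'.erase 0 := by rw [hPab]; simp
          exact Finset.mem_of_mem_erase this)
      (by intro z hz; simp only [Finset.mem_insert, Finset.mem_singleton] at hz ⊢; tauto) (by simp)
    exact le_trans this (le_max_of_le_left (le_max_left _ _))

/-- **THE NODE RULE FOR A THREE-BIT CONFIGURATION**: every valid split of `{0, -a, -b}`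
(`1 ≤ a < b ≤ q - 1`) is dominated by one of the eight injected options. -/
theorem split_three_le (hq : 1 ≤ q) (A B : SumTree) {a b : ℕ} (ha : 1 ≤ a) (hab : a < b)
    (hbq : b + 1 ≤ q) {A' B' : Finset ℤ}
    (h : (A', B') ∈ splits q ({0, -(a : ℤ), -(b : ℤ)} : Finset ℤ) 0) :
    treeBR q A A' + treeBR q B B' ≤
      max
        (max (max (treeBR q A {0, -(a : ℤ), -(b : ℤ)} + treeBR q B {-(q : ℤ)})
              (treeBR q A {0, -(a : ℤ)} + treeBR q B {-(b : ℤ), -(q : ℤ)}))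
          (max (treeBR q A {0, -(b : ℤ)} + treeBR q B {-(a : ℤ), -(q : ℤ)})
              (treeBR q A {0} + treeBR q B {-(a : ℤ), -(b : ℤ), -(q : ℤ)})))
        (max (max (treeBR q B {0, -(a : ℤ), -(b : ℤ)} + treeBR q A {-(q : ℤ)})
              (treeBR q B {0, -(a : ℤ)} + treeBR q A {-(b : ℤ), -(q : ℤ)}))
          (max (treeBR q B {0, -(b : ℤ)} + treeBR q A {-(a : ℤ), -(q : ℤ)})
              (treeBR q B {0} + treeBR q A {-(a : ℤ), -(b : ℤ), -(q : ℤ)}))) := by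
  by_cases h0 : (0 : ℤ) ∈ A'
  · exact le_trans (split_three_le_left hq A B ha hab hbq h h0) (le_max_left _ _)
  · -- 0 ∈ B' : the mirror case
    obtain ⟨-, -, -, hcov, -, -⟩ := of_mem_splits (A := A') (B := B') h
    have h0B : (0 : ℤ) ∈ B' := by
      have := hcov (show (0 : ℤ) ∈ ({0, -(a : ℤ), -(b : ℤ)} : Finset ℤ) by simp)
      rcases Finset.mem_union.1 this with h' | h'
      · exact absurd h' h0
      · exact h'
    have := split_three_le_left hq B A ha hab hbq (swap_mem_splits h) h0B
    rw [add_comm] at this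
    exact le_trans this (le_max_right _ _)

/-- THE VALUE OF A THREE-BIT CONFIGURATION AT A NODE is `1 +` at most the best of the eight
injected options (`treeBRw_node_le` with `split_three_le`). -/
theorem treeBR_three_node_le (hq : 1 ≤ q) (A B : SumTree) {a b : ℕ} (ha : 1 ≤ a) (hab : a < b)
    (hbq : b + 1 ≤ q) {R : ℚ} (hR : 0 ≤ R)
    (h8 : max
        (max (max (treeBR q A {0, -(a : ℤ), -(b : ℤ)} + treeBR q B {-(q : ℤ)})
              (treeBR q A {0, -(a : ℤ)} + treeBR q B {-(b : ℤ), -(q : ℤ)}))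
          (max (treeBR q A {0, -(b : ℤ)} + treeBR q B {-(a : ℤ), -(q : ℤ)})
              (treeBR q A {0} + treeBR q B {-(a : ℤ), -(b : ℤ), -(q : ℤ)})))
        (max (max (treeBR q B {0, -(a : ℤ), -(b : ℤ)} + treeBR q A {-(q : ℤ)})
              (treeBR q B {0, -(a : ℤ)} + treeBR q A {-(b : ℤ), -(q : ℤ)}))
          (max (treeBR q B {0, -(b : ℤ)} + treeBR q A {-(a : ℤ), -(q : ℤ)})
              (treeBR q B {0} + treeBR q A {-(a : ℤ), -(b : ℤ), -(q : ℤ)}))) ≤ R) :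
    treeBR q (.node A B) {0, -(a : ℤ), -(b : ℤ)} ≤ 1 + R := by
  have hne : ({0, -(a : ℤ), -(b : ℤ)} : Finset ℤ).Nonempty := Finset.insert_nonempty _ _
  have hmax : ({0, -(a : ℤ), -(b : ℤ)} : Finset ℤ).max' hne = 0 := by
    refine le_antisymm (Finset.max'_le _ hne _ fun z hz => ?_) (Finset.le_max' _ _ (by simp))
    simp only [Finset.mem_insert, Finset.mem_singleton] at hz; omega
  have h := treeBRw_node_le (q := q) (W := fun e => (2 : ℚ) ^ e) (a := A) (b := B) hne hR
    (fun AB hAB => by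
      rw [hmax] at hAB
      have := split_three_le hq A B ha hab hbq (A' := AB.1) (B' := AB.2) hAB
      unfold treeBR at this
      exact le_trans this h8)
  rw [hmax, zpow_zero] at h
  exact h

end ThreeFam

end Summit.Ventures.CertifiedArithmetic.LowPrec.Opt
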